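import Summits.CriticalPhenomena.PercolationContinuityZ3.Theorems.PercNearOneGluingNoHeavyLowerTailForestRayleighFivePinned
import Summits.CriticalPhenomena.PercolationContinuityZ3.Theorems.PercNearOneGluingNoHeavyLowerTailForestRayleighKFiveSub
import Summits.CriticalPhenomena.PercolationContinuityZ3.Theorems.PercNearOneGluingNoHeavyLowerTailForestRayleighKFiveTopA
import Summits.CriticalPhenomena.PercolationContinuityZ3.Theorems.PercNearOneGluingNoHeavyLowerTailForestRayleighKFiveTopB
import Summits.CriticalPhenomena.PercolationContinuityZ3.Theorems.PercNearOneGluingNoHeavyLowerTailForestRayleighKFiveTopC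
import HarnessLib

/-!
# Weighted forest negative correlation — `K₅` is forest-Rayleigh  III: the theorem

`K₅` on `Fin 5`. `forestsW_rayleigh_K5_fin`: the complete graph on five vertices has the
weighted forest Rayleigh property — so **every graph on at most five vertices is forest-Rayleigh**
(sub-systems inherit, `rayleigh_mono`), i.e. the Grimmett–Winkler / Kahn / Pemantle negative
correlation conjecture for uniform and weighted random forests holds for all graphs on `≤ 5`
vertices, for every pair of edges (Grimmett–Winkler 2004 checked the uniform case on ≤ 8 vertices by
computer, as reported in the Semple–Welsh 2008 abstract; Erickson 2008, Cor. 5.3.2, proves the I-Rayleigh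
property on ≤ 7 vertices by Maple SOS; Semple–Welsh 2008 §4 exhibit the 228-term `K₅` polynomial; here a
kernel proof of the weighted 5-vertex case). Proof: pinned instances contract
to `K₄`; instances missing an edge live in a copy of `K₅ − e` (`…KFiveE`); instances using all ten
edges are the two top cells `…FiveTop13–14` (S–W's 228-term polynomial and its adjacent analogue) up
to symmetry. Theorems only; no definitions, no `sorry`.
-/

open Finset SimpleGraph
open scoped Classical

namespace Summit.CriticalPhenomena.PercolationContinuityZ3.Theorems.ForestRayleigh

/-- `(R)` for the instances of `K5` that use every edge with nothing pinned (`K = ∅`). -/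
theorem K5_full_top (w : Sym2 (Fin 5) → ℝ) (hw : ∀ x, 0 ≤ w x) (D : Finset (Sym2 (Fin 5)))
    (e f : Sym2 (Fin 5)) (hsub : D ∪ insert e (insert f (∅ : Finset (Sym2 (Fin 5)))) ⊆ ({s(0, 1), s(0, 2), s(0, 3), s(0, 4), s(1, 2), s(1, 3), s(1, 4), s(2, 3), s(2, 4), s(3, 4)} : Finset (Sym2 (Fin 5))))
    (hfull : ({s(0, 1), s(0, 2), s(0, 3), s(0, 4), s(1, 2), s(1, 3), s(1, 4), s(2, 3), s(2, 4), s(3, 4)} : Finset (Sym2 (Fin 5))) ⊆ D ∪ insert e (insert f (∅ : Finset (Sym2 (Fin 5)))))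
    (heD : e ∉ D) (hfD : f ∉ D) (hef : e ≠ f) :
    (∑ G ∈ D.powerset.filter (fun G =>
        (fromEdgeSet ((G ∪ (insert e (insert f (∅ : Finset (Sym2 (Fin 5))))) : Finset (Sym2 (Fin 5))) : Set (Sym2 (Fin 5)))).IsAcyclic), ∏ y ∈ G, w y) *
      (∑ G ∈ D.powerset.filter (fun G =>
        (fromEdgeSet ((G ∪ ((∅ : Finset (Sym2 (Fin 5)))) : Finset (Sym2 (Fin 5))) : Set (Sym2 (Fin 5)))).IsAcyclic), ∏ y ∈ G, w y) ≤
    (∑ G ∈ D.powerset.filter (fun G =>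
        (fromEdgeSet ((G ∪ (insert e (∅ : Finset (Sym2 (Fin 5)))) : Finset (Sym2 (Fin 5))) : Set (Sym2 (Fin 5)))).IsAcyclic), ∏ y ∈ G, w y) *
      (∑ G ∈ D.powerset.filter (fun G =>
        (fromEdgeSet ((G ∪ (insert f (∅ : Finset (Sym2 (Fin 5)))) : Finset (Sym2 (Fin 5))) : Set (Sym2 (Fin 5)))).IsAcyclic), ∏ y ∈ G, w y) := by
  have he : e ∈ ({s(0, 1), s(0, 2), s(0, 3), s(0, 4), s(1, 2), s(1, 3), s(1, 4), s(2, 3), s(2, 4), s(3, 4)} : Finset (Sym2 (Fin 5))) := hsub (by simp)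
  have key : ∀ z : Sym2 (Fin 5), z ∈ ({s(0, 1), s(0, 2), s(0, 3), s(0, 4), s(1, 2), s(1, 3), s(1, 4), s(2, 3), s(2, 4), s(3, 4)} : Finset (Sym2 (Fin 5))) → z ∈ ({s(0, 1), s(0, 2), s(0, 3)} : Finset (Sym2 (Fin 5))) ∨ z ∈ ({s(0, 4), s(1, 2), s(1, 3), s(1, 4)} : Finset (Sym2 (Fin 5))) ∨ z ∈ ({s(2, 3), s(2, 4), s(3, 4)} : Finset (Sym2 (Fin 5))) := by decide
  rcases key e he with h | h | h
  · exact K5_full_top_1 w hw D e f hsub hfull heD hfD hef h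
  · exact K5_full_top_2 w hw D e f hsub hfull heD hfD hef h
  · exact K5_full_top_3 w hw D e f hsub hfull heD hfD hef h

/-- **`K5` on `Fin 5` has the weighted forest Rayleigh property**: `(R)(D;K;e,f)` for every
instance inside it and all activities. [top cells + contraction + deletion] -/
theorem forestsW_rayleigh_K5_fin :
    ∀ (w : Sym2 (Fin 5) → ℝ), (∀ x, 0 ≤ w x) → ∀ (D K : Finset (Sym2 (Fin 5))) (e f : Sym2 (Fin 5)),
      D ∪ insert e (insert f K) ⊆ ({s(0, 1), s(0, 2), s(0, 3), s(0, 4), s(1, 2), s(1, 3), s(1, 4), s(2, 3), s(2, 4), s(3, 4)} : Finset (Sym2 (Fin 5))) → Disjoint D K → e ∉ D → e ∉ K → f ∉ D →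
      f ∉ K → e ≠ f →
      (∑ G ∈ D.powerset.filter (fun G =>
        (fromEdgeSet ((G ∪ (insert e (insert f (K))) : Finset (Sym2 (Fin 5))) : Set (Sym2 (Fin 5)))).IsAcyclic), ∏ y ∈ G, w y) *
        (∑ G ∈ D.powerset.filter (fun G =>
        (fromEdgeSet ((G ∪ (K) : Finset (Sym2 (Fin 5))) : Set (Sym2 (Fin 5)))).IsAcyclic), ∏ y ∈ G, w y) ≤
      (∑ G ∈ D.powerset.filter (fun G =>
        (fromEdgeSet ((G ∪ (insert e (K)) : Finset (Sym2 (Fin 5))) : Set (Sym2 (Fin 5)))).IsAcyclic), ∏ y ∈ G, w y) *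
        (∑ G ∈ D.powerset.filter (fun G =>
        (fromEdgeSet ((G ∪ (insert f (K)) : Finset (Sym2 (Fin 5))) : Set (Sym2 (Fin 5)))).IsAcyclic), ∏ y ∈ G, w y) := by
  intro w hw D K e f hsub hDK heD heK hfD hfK hef
  have hL : ∀ z ∈ D ∪ insert e (insert f K), ¬z.IsDiag := by
    have hT : ∀ z ∈ ({s(0, 1), s(0, 2), s(0, 3), s(0, 4), s(1, 2), s(1, 3), s(1, 4), s(2, 3), s(2, 4), s(3, 4)} : Finset (Sym2 (Fin 5))), ¬z.IsDiag := by decide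
    exact fun z hz => hT z (hsub hz)
  by_cases hK : K.Nonempty
  · exact lsm_of_pinned_fin5 w hw D K e f hDK heD heK hfD hfK hef hL hK
  rw [Finset.not_nonempty_iff_eq_empty] at hK
  subst hK
  by_cases hfull : ({s(0, 1), s(0, 2), s(0, 3), s(0, 4), s(1, 2), s(1, 3), s(1, 4), s(2, 3), s(2, 4), s(3, 4)} : Finset (Sym2 (Fin 5))) ⊆ D ∪ insert e (insert f (∅ : Finset (Sym2 (Fin 5))))
  · exact K5_full_top w hw D e f hsub hfull heD hfD hef
  · obtain ⟨g, hg, hgn⟩ := Finset.not_subset.1 hfull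
    have hsub' : D ∪ insert e (insert f (∅ : Finset (Sym2 (Fin 5)))) ⊆ (({s(0, 1), s(0, 2), s(0, 3), s(0, 4), s(1, 2), s(1, 3), s(1, 4), s(2, 3), s(2, 4), s(3, 4)} : Finset (Sym2 (Fin 5)))).erase g :=
      fun z hz => Finset.mem_erase.2 ⟨fun h => hgn (h ▸ hz), hsub hz⟩
    simp only [Finset.mem_insert, Finset.mem_singleton] at hg
    rcases hg with rfl | rfl | rfl | rfl | rfl | rfl | rfl | rfl | rfl | rfl
    · exact K5_minus_01 w hw D _ e f hsub' hDK heD heK hfD hfK hef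
    · exact K5_minus_02 w hw D _ e f hsub' hDK heD heK hfD hfK hef
    · exact K5_minus_03 w hw D _ e f hsub' hDK heD heK hfD hfK hef
    · exact K5_minus_04 w hw D _ e f hsub' hDK heD heK hfD hfK hef
    · exact K5_minus_12 w hw D _ e f hsub' hDK heD heK hfD hfK hef
    · exact K5_minus_13 w hw D _ e f hsub' hDK heD heK hfD hfK hef
    · exact K5_minus_14 w hw D _ e f hsub' hDK heD heK hfD hfK hef
    · exact K5_minus_23 w hw D _ e f hsub' hDK heD heK hfD hfK hef
    · exact K5_minus_24 w hw D _ e f hsub' hDK heD heK hfD hfK hef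
    · exact K5_minus_34 w hw D _ e f hsub' hDK heD heK hfD hfK hef

end Summit.CriticalPhenomena.PercolationContinuityZ3.Theorems.ForestRayleigh
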